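import Mathlib.AlgebraicGeometry.IdealSheaf.Basic
import Mathlib.RingTheory.Localization.Ideal
import HarnessLib

/-!
# `EquisingularLift` (stmt-ResolutionOfSingularities-15660), line `Sketch` v10b — extension of sections of an ideal sheaf
# across a basic open (Hartshorne II Lemma 5.14 for ideals)

[OURS · L1 W4.5b] Helper for the registered stub `stub_linearCentre_of_blowupModel` of the crux `EquisingularLift`
(Step E of `STUB-PLAN-linearCentre_of_blowupModel.md`); NOT a statement of any manuscript.

For a quasi-coherent ideal sheaf `𝔞` on a scheme `Y`, an affine open `U`, `s, t ∈ Γ(Y, U)`: if the restriction of `t` to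
the basic open `U_s` lies in `𝔞(U_s)`, then `s^N · t ∈ 𝔞(U)` for some `N` — because `𝔞(U_s) = 𝔞(U) · Γ(U_s)` (Mathlib
`IdealSheafData.map_ideal_basicOpen`) and `Γ(U_s) = Γ(U)[s⁻¹]` (`IsAffineOpen.isLocalization_basicOpen`).
-/

set_option linter.dupNamespace false -- mandated namespace `Summit.<Summit>.<Problem>` of this single-conjunct summit

noncomputable section

open CategoryTheory AlgebraicGeometry TopologicalSpace

namespace Summit.ResolutionOfSingularities.ResolutionOfSingularities.Cruxes.EquisingularLift.StrataSplit

namespace LinearCentre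

universe u

/-- **Clearing the denominator of a section of an ideal sheaf** (Hartshorne II Lemma 5.14 (b) for ideal sheaves): if
`t|_{U_s} ∈ 𝔞(U_s)` then `s^N t ∈ 𝔞(U)` for some `N`. [cite: Hartshorne1977, II Lemma 5.14] -/
theorem exists_pow_mul_mem_ideal {Y : Scheme.{u}} (𝔞 : Y.IdealSheafData) (U : Y.affineOpens) (s t : Γ(Y, U))
    (ht : Y.presheaf.map (homOfLE (Y.basicOpen_le s)).op t ∈ 𝔞.ideal (Y.affineBasicOpen s)) :
    ∃ N : ℕ, s ^ N * t ∈ 𝔞.ideal U := by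
  have inst := U.2.isLocalization_basicOpen s
  rw [← 𝔞.map_ideal_basicOpen U s] at ht
  change algebraMap Γ(Y, U) Γ(Y, Y.basicOpen s) t ∈
    (𝔞.ideal U).map (algebraMap Γ(Y, U) Γ(Y, Y.basicOpen s)) at ht
  rw [IsLocalization.mem_map_algebraMap_iff (Submonoid.powers s)] at ht
  obtain ⟨⟨⟨i, hi⟩, ⟨_, ⟨a, rfl⟩⟩⟩, h⟩ := ht
  -- `t * s^a = i` in the localization, so `s^b * (t * s^a) = s^b * i` in `Γ(Y, U)` for some `b`
  change algebraMap Γ(Y, U) Γ(Y, Y.basicOpen s) t * algebraMap Γ(Y, U) Γ(Y, Y.basicOpen s) (s ^ a) =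
    algebraMap Γ(Y, U) Γ(Y, Y.basicOpen s) i at h
  rw [← map_mul] at h
  obtain ⟨⟨_, ⟨b, rfl⟩⟩, hb⟩ := (IsLocalization.eq_iff_exists (Submonoid.powers s) _).mp h
  refine ⟨b + a, ?_⟩
  have : s ^ (b + a) * t = s ^ b * i := by
    rw [pow_add]
    change s ^ b * (t * s ^ a) = s ^ b * i at hb
    rw [mul_assoc, mul_comm (s ^ a) t]
    exact hb
  rw [this]
  exact Ideal.mul_mem_left _ _ hi

end LinearCentre

end Summit.ResolutionOfSingularities.ResolutionOfSingularities.Cruxes.EquisingularLift.StrataSplit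

end
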